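import Summits.CriticalPhenomena.PercolationContinuityZ3.Theorems.PercNearOneGluingNoHeavyLowerTailSahiTwoLevelHalf
import Summits.CriticalPhenomena.PercolationContinuityZ3.Theorems.SahiConjectureUniform
import Literature.Combinatorics.Sahi2008.KahnQuestionOne

/-!
# The fair product weight on `Set (Fin r)` suffices: `HALF(½) ⟹` Kahn's Conjecture 5

Support file of the one-cut programme (crux `NoHeavyLowerTail`, stmt-CriticalPhenomena-4575; cell `prim-bnk`, seat bnk-2 gen 11,
memo `run/shared/lean/prim/prim-l12/FROM-prim-bnk-2-g11-GOOD-AXIS.md` §13).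

The reduction "Sahi's `C_n` (resp. Kahn's Conjecture 5) ⟺ `C_n` for the UNIFORM cubes `{0,1}^M`" is the tree's
`SahiConjectureUniform.lean` (`sahiConjecture_iff_forall_uniformWeight_fin`, dyadic threshold coins + continuity,
[LiebSahi2021, Lemma 2.3], proved in `Literature/Combinatorics/Sahi2008/UniformCube.lean`), stated for `uniformWeight (Fin M)` on
the cube `Fin M → Bool`.  The two-level files of this programme (`…SahiGoodAxis`, `…SahiTwoLevelHalf`) speak the percolation
vocabulary instead — the product weight `bernoulliWeight (fun _ => 1/2)` on `Set (Fin r)` and indicators `ind U` of up-sets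
`U ⊆ Set (Fin r)`.  This file is the few-line TRANSPORT between the two (along the Boolean-coordinates order isomorphism
`Literature.Combinatorics.Sahi2008.Kahn2022.setCube`), so that the uniform-measure rung `SahiTwoLevelHalf.Half` closes onto Kahn's conjecture:

* `sahiPositive_uniformWeight_of_half` — order-`n` Sahi positivity of `bernoulliWeight ½` on `Set (Fin M)` gives it for
  `uniformWeight (Fin M)` (push-forward along `setCube`);
* `sahiConjecture_iff_forall_half`, `masterFamilyNonneg_iff_forall_half`, `kahnConjecture_iff_forall_half` — `C_n`, the master
  family and Kahn's Conjecture 5 are each equivalent to their case `q ≡ 1/2` on every `Fin r` (events form: the statement called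
  `C3Uniform` in the docstrings of `…SahiTwoLevelHalf`, which is NOT re-declared here — the Summits-side obligation stays
  `KahnConjecture` / `SahiConjecture 3`);
* `kahnConjecture_of_half`, `masterFamilyNonneg_three_of_half` — **HALF(½) ⟹ Kahn's Conjecture 5**.

Nothing here asserts any conjecture; axioms standard. [this work]
-/

noncomputable section

namespace Summit.CriticalPhenomena.PercolationContinuityZ3.Theorems

open Literature.Combinatorics.Sahi2008
open Literature.Combinatorics.Sahi2008.Kahn2022 (setCube setCube_mono bernoulliWeight_eq_coinWeight_setCube)
open Literature.Probability.Percolation.DecisionTree (ind ind_of_mem ind_of_not_mem)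
open SahiTwoLevelHalf (half Half c3_uniform_of_half)

namespace SahiUniform

/-! ### Transport `Set (Fin M) ≃o (Fin M → Bool)` -/

/-- In Boolean coordinates the fair product weight on `Set (Fin M)` is the uniform weight `2^{-M}` on the cube.
[cite: Kahn2022, p. 2 footnote 1 (b); LiebSahi2021, §2 (before Lemma 2.2)] -/
theorem bernoulliWeight_half_eq_uniformWeight {M : ℕ} (T : Set (Fin M)) :
    bernoulliWeight (fun _ : Fin M => half) T = uniformWeight (Fin M) (setCube M T) :=
  bernoulliWeight_eq_coinWeight_setCube (fun _ : Fin M => (1 / 2 : ℝ)) (fun _ => ⟨by norm_num, by norm_num⟩) T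

/-- The push-forward of the fair product weight along `setCube` is the uniform weight.
[cite: Kahn2022, p. 2 footnote 1 (b); LiebSahi2021, §2 (before Lemma 2.2)] -/
theorem pushWeight_bernoulliWeight_half_setCube (M : ℕ) :
    pushWeight (bernoulliWeight fun _ : Fin M => half) (setCube M) = uniformWeight (Fin M) := by
  funext y
  rw [pushWeight_equiv, bernoulliWeight_half_eq_uniformWeight, Equiv.apply_symm_apply]

/-- **Transport of Sahi positivity**: if the fair product weight on `Set (Fin M)` is Sahi-positive of order `n`, so is the
uniform weight on `Fin M → Bool` (positivity travels along the monotone bijection `setCube`).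
[cite: Kahn2022, p. 2 (Underlying independents) and footnote 1 (b); LiebSahi2021, §2] -/
theorem sahiPositive_uniformWeight_of_half {n M : ℕ} (h : SahiPositive (bernoulliWeight fun _ : Fin M => half) n) :
    SahiPositive (uniformWeight (Fin M)) n := by
  rw [← pushWeight_bernoulliWeight_half_setCube M]
  exact h.of_pushWeight (setCube_mono M)

/-- Layer cake at a fixed product weight: `E_n ≥ 0` on indicators of up-sets gives order-`n` Sahi positivity
(`sahiPositive_iff_indicators`, with the `Finset`/`Set` indicator plumbing of `masterFamilyNonneg_iff_sahiPositive`).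
[cite: LiebSahi2021, Lemma 2.2; Kahn2022, Conj. 5 (arXiv p. 3)] -/
theorem sahiPositive_of_forall_upperSet {ι : Type} [Fintype ι] (p : ι → unitInterval) {n : ℕ}
    (h : ∀ U : Fin n → Set (Set ι), (∀ i, IsUpperSet (U i)) → 0 ≤ sahiE (bernoulliWeight p) n (fun i => ind (U i))) :
    SahiPositive (bernoulliWeight p) n := by
  classical
  rw [sahiPositive_iff_indicators]
  intro Uf hUf
  have e : (fun i => setInd (Uf i)) = fun i => ind ((Uf i : Finset (Set ι)) : Set (Set ι)) := by
    funext i ω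
    by_cases hω : ω ∈ Uf i
    · rw [setInd_apply, if_pos hω, ind_of_mem (Finset.mem_coe.2 hω)]
    · rw [setInd_apply, if_neg hω, ind_of_not_mem fun h' => hω (Finset.mem_coe.1 h')]
  rw [e]
  exact h (fun i => (Uf i : Set (Set ι))) hUf

/-! ### `q ≡ 1/2` on every `Fin r` suffices -/

/-- **`C_n` ⟺ `C_n` for the fair product weights**: `SahiConjecture n ↔` for every `r` the product weight `q ≡ 1/2` on
`Set (Fin r)` is Sahi-positive of order `n` (the tree's `sahiConjecture_iff_forall_uniformWeight_fin`, transported).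
[cite: LiebSahi2021, §2 and Lemma 2.3; Kahn2022, pp. 2–3] -/
theorem sahiConjecture_iff_forall_half (n : ℕ) :
    SahiConjecture n ↔ ∀ r : ℕ, SahiPositive (bernoulliWeight fun _ : Fin r => half) n :=
  ⟨fun hC r => (sahiConjecture_iff_forall_bernoulliWeight n).1 hC (Fin r) _,
    fun h => (sahiConjecture_iff_forall_uniformWeight_fin n).2 fun M => sahiPositive_uniformWeight_of_half (h M)⟩

/-- **The master family at `q ≡ 1/2` suffices**: `MasterFamilyNonneg k ↔ E_k(μ_{1/2}; 1_{U_0},…,1_{U_{k−1}}) ≥ 0` for all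
`k`-tuples of increasing events of every finite cube `Fin r` under the fair product measure.
[cite: LiebSahi2021, Lemma 2.2 and Lemma 2.3; Kahn2022, pp. 2–3] -/
theorem masterFamilyNonneg_iff_forall_half (k : ℕ) :
    MasterFamilyNonneg k ↔ ∀ (r : ℕ) (U : Fin k → Set (Set (Fin r))), (∀ j, IsUpperSet (U j)) →
      0 ≤ sahiE (bernoulliWeight fun _ : Fin r => half) k (fun j => ind (U j)) :=
  ⟨fun h r U hU => h (Fin r) _ U hU,
    fun h => sahiConjecture_le_masterFamilyNonneg k
      ((sahiConjecture_iff_forall_half k).2 fun r => sahiPositive_of_forall_upperSet _ (h r))⟩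

/-- **Kahn's Conjecture 5 ⟺ its case `q ≡ 1/2`**: `KahnConjecture ↔ E_3(μ_{1/2}; 1_A,1_B,1_C) ≥ 0` for all increasing
`A, B, C ⊆ Set (Fin r)`, all `r` — the events form at the fair product weight (the statement called `C3Uniform` in
`…SahiTwoLevelHalf`; equivalently `kahnConjecture_iff_counting` of `SahiConjectureUniform.lean`).
[cite: LiebSahi2021, Lemma 2.2 and Lemma 2.3; Kahn2022, Conj. 5 (arXiv p. 3) and pp. 2–3] -/
theorem kahnConjecture_iff_forall_half :
    KahnConjecture ↔ ∀ (r : ℕ) (U : Fin 3 → Set (Set (Fin r))), (∀ j, IsUpperSet (U j)) →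
      0 ≤ sahiE (bernoulliWeight fun _ : Fin r => half) 3 (fun j => ind (U j)) := by
  rw [← masterFamilyNonneg_three_iff_kahnConjecture]
  exact masterFamilyNonneg_iff_forall_half 3

/-! ### `HALF(½) ⟹` Kahn's Conjecture 5 -/

/-- **HALF(½) ⟹ Kahn's Conjecture 5**: the uniform-measure square-domination rung `SahiTwoLevelHalf.Half`
(`E_3(U) ≥ ¼[E_3(U^{a←1}) + E_3(U^{a←0})]` along every axis at `q ≡ 1/2`) gives `C_3` at the fair weight on every `Fin r`
(`SahiTwoLevelHalf.c3_uniform_of_half`), hence Kahn's conjecture for every product measure (`kahnConjecture_iff_forall_half`).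
[this work] -/
theorem kahnConjecture_of_half (hH : Half) : KahnConjecture :=
  kahnConjecture_iff_forall_half.2 (c3_uniform_of_half hH)

/-- **HALF(½) ⟹ the master family at `k = 3`** (every product measure on every finite cube). [this work] -/
theorem masterFamilyNonneg_three_of_half (hH : Half) : MasterFamilyNonneg 3 :=
  masterFamilyNonneg_three_iff_kahnConjecture.2 (kahnConjecture_of_half hH)

/-- **HALF(½) ⟹ Sahi's `C_3`** for every FKG probability weight on every finite distributive lattice. [this work] -/
theorem sahiConjecture_three_of_half (hH : Half) : SahiConjecture 3 :=
  sahiConjecture_three_iff_kahnConjecture.2 (kahnConjecture_of_half hH)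

end SahiUniform

end Summit.CriticalPhenomena.PercolationContinuityZ3.Theorems
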